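import Summits.ResolutionOfSingularities.ResolutionOfSingularities.Theorems.HilbertSamuelEliminationSigmaMaxModificationsCorridor3WLadderStrataDepthRuledComponent
import HarnessLib

/-!
# [OURS · L1 W4.2] `Corridor3WLadderStrataDepthBlowup` — the depth laws over an ABSTRACT permissible blow-up step (no oracle, no
# `StepProjection`, no `CycleInv`): the form the σ-layer (`StrategyE` / menu-disciplined runs, res-L1-type-o1 · res-type-040's Ω family)
# can call at any σ-step «blow-up in a permissible centre through the marked point»

Crux chain w42 (`SigmaMaxModifications`, stmt-ResolutionOfSingularities-18506; conjunct `SigmaMaxModificationsCorridor3`,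
stmt-ResolutionOfSingularities-19249); res-type-053 gen 10 after (DG) ROW-J SUPPORT (p525662 · p526642 · p527422 · p528109) — res-L1-w42-plan-1
RULINGS v3.14-8 (CA): «CONTINUE: strategy-AGNOSTIC LOCAL laws and bricks». The statements of `…StrataDepthRuled(Component)` are re-cut here
over the bare data «`f : W' ⟶ W` a blow-up (`IsBlowup f C`) of a locally Noetherian `W` of dimension `≤ 3` in a centre `C` permissible at the
closed point `y`, `x' ∈ W'` closed over `y`, `Z' ∋ x'` irreducible closed» — so that ANY strategy whose steps are permissible blow-ups (not only
σ_CJS's canonical steps) can use them. OURS (cell res-hironaka, slot W4.2); NOT statements of H. Hironaka's manuscript [Hironaka2017] nor of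
[CossartJannsenSaito2020]; AI-proved, weaker than expert review. Sorry-free PROOF file (no definition, no named fact, no binder).
`--supports stmt-ResolutionOfSingularities-19249 --as helper`.

* `IsBlowup.exists_fibre_generization_of_sandwich` — sandwich at `x'` in `Z'`, none at `y` in `cl f(Z')` ⇒ `Z'` contains a generisation
  `z' ≠ x'` of `x'` in the fibre `f⁻¹(y)` (any morphism data; really `exists_mem_fibre_specializes_of_coheight_lt`).
* `IsBlowup.sandwich_image_of_two_le_coheight_support` — centre of codimension `≥ 2` at `y` in its support, `dim W ≤ 3`: a sandwich at `x'`
  in `Z'` forces one at `y` in `cl f(Z')` (NO depth jump over a surface centre).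
* `IsBlowup.exists_fibre_component_subset_of_sandwich` — centre of codimension `≥ 1` at `y`, `dim W ≤ 3`: a depth jump puts a whole
  irreducible component `cl z'` of `f⁻¹(y)` through `x'` inside `Z'`.
-/

noncomputable section

set_option linter.dupNamespace false

open CategoryTheory AlgebraicGeometry TopologicalSpace Topology Order IsLocalRing
open Literature.AlgebraicGeometry.Resolution Literature.RingTheory.HilbertSamuel
open Summit.ResolutionOfSingularities.ResolutionOfSingularities.Theorems.SigmaMaxModificationsCorridor3
open Scheme.IdealSheafData

namespace Summit.ResolutionOfSingularities.ResolutionOfSingularities.Theorems.SigmaMaxModificationsCorridor3.Moving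

universe u

variable {W W' : Scheme.{u}} {f : W' ⟶ W} {C : W.IdealSheafData}


/-- **A depth jump is carried by the fibre** (bare form): for `f : W' ⟶ W` of locally Noetherian schemes, `x'` and `y = f x'` closed,
`Z' ∋ x'` irreducible closed with a sandwich at `x'` and none at `y` in `cl f(Z')`: some `z' ∈ Z'`, `z' ⤳ x'`, `z' ≠ x'`, `f z' = y`.
[cite: Matsumura1987, Thm. 15.1] -/
theorem exists_fibre_generization_of_sandwich [IsLocallyNoetherian W] [IsLocallyNoetherian W'] (f : W' ⟶ W) {x' : W'}
    (hxc : IsClosed ({x'} : Set W')) (hyc : IsClosed ({f.base x'} : Set W)) {Z' : Set W'} (hirr : IsIrreducible Z') (hcl : IsClosed Z')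
    (hx' : x' ∈ Z') (hup : ∃ B : Set W', IsIrreducible B ∧ IsClosed B ∧ x' ∈ B ∧ B ⊆ Z' ∧ B ≠ {x'} ∧ B ≠ Z')
    (hdown : ¬ ∃ B : Set W, IsIrreducible B ∧ IsClosed B ∧ f.base x' ∈ B ∧ B ⊆ closure (f.base '' Z') ∧
      B ≠ {f.base x'} ∧ B ≠ closure (f.base '' Z')) :
    ∃ z' ∈ Z', z' ⤳ x' ∧ z' ≠ x' ∧ f.base z' = f.base x' := by
  have hgen : IsGenericPoint hirr.genericPoint Z' := hirr.isGenericPoint_genericPoint hcl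
  set ζ' := hirr.genericPoint with hζ'def
  have hsp : ζ' ⤳ x' := hgen.specializes hx'
  have hirrB : IsIrreducible (closure (f.base '' Z')) := (hirr.image f.base f.continuous.continuousOn).closure
  have hBeq : closure (f.base '' Z') = closure {f.base ζ'} := by
    apply le_antisymm
    · refine closure_minimal ?_ isClosed_closure
      rintro _ ⟨z, hz, rfl⟩
      exact specializes_iff_mem_closure.mp ((hgen.specializes hz).map f.continuous)
    · exact closure_minimal (Set.singleton_subset_iff.mpr (subset_closure ⟨ζ', hgen.mem, rfl⟩)) isClosed_closure
  have h2 : 2 ≤ coheight (⟨x', hx'⟩ : ↥Z') := (two_le_coheight_iff_exists_sandwich hirr hcl hx' hxc).mpr hup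
  have hB1 : coheight (⟨f.base x', subset_closure ⟨x', hx', rfl⟩⟩ : ↥(closure (f.base '' Z'))) ≤ 1 := by
    by_contra hlt
    exact hdown ((two_le_coheight_iff_exists_sandwich hirrB isClosed_closure (subset_closure ⟨x', hx', rfl⟩) hyc).mp
      (Order.add_one_le_of_lt (not_le.mp hlt)))
  have e1 : coheight (⟨x', hx'⟩ : ↥Z') = coheight (⟨x', specializes_iff_mem_closure.mp hsp⟩ : ↥(closure ({ζ'} : Set W'))) :=
    (coheight_orderIso (OrderIso.setCongr _ _ hgen.def.symm) ⟨x', hx'⟩).symm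
  have e2 : coheight (⟨f.base x', subset_closure ⟨x', hx', rfl⟩⟩ : ↥(closure (f.base '' Z'))) =
      coheight (⟨f.base x', specializes_iff_mem_closure.mp (hsp.map f.continuous)⟩ : ↥(closure ({f.base ζ'} : Set W))) :=
    (coheight_orderIso (OrderIso.setCongr (closure (f.base '' Z')) (closure ({f.base ζ'} : Set W)) hBeq)
      ⟨f.base x', subset_closure ⟨x', hx', rfl⟩⟩).symm
  have hlt : coheight (⟨f.base x', specializes_iff_mem_closure.mp (hsp.map f.continuous)⟩ : ↥(closure ({f.base ζ'} : Set W))) <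
      coheight (⟨x', specializes_iff_mem_closure.mp hsp⟩ : ↥(closure ({ζ'} : Set W'))) := by
    rw [← e1, ← e2]
    exact lt_of_le_of_lt hB1 (lt_of_lt_of_le (by decide) h2)
  obtain ⟨z', hζz, hzx, hne, hfz⟩ := exists_mem_fibre_specializes_of_coheight_lt f hsp hlt
  refine ⟨z', ?_, hzx, hne, hfz⟩
  rw [← hgen.def]
  exact specializes_iff_mem_closure.mp hζz

/-- **No depth jump over a surface centre** (bare form): `f : W' ⟶ W` a blow-up of a locally Noetherian `W` of dimension `≤ 3` in `C`,
permissible at the closed point `y = f x'` with `2 ≤ codim_{V(C)}(y)`; `x'` closed; `Z' ∋ x'` irreducible closed with a sandwich at `x'`.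
Then `cl f(Z')` has a sandwich at `y`. Any characteristic, any strategy. [cite: CossartJannsenSaito2020, Thm. 3.10 (proof, p. 46)]
[cite: Matsumura1987, Thm. 15.1] -/
theorem IsBlowup.sandwich_image_of_two_le_coheight_support [IsLocallyNoetherian W] [IsLocallyNoetherian W'] (hbl : IsBlowup f C)
    (hdimW : topologicalKrullDim W ≤ ((3 : ℕ) : WithBot ℕ∞)) {x' : W'} (hxc : IsClosed ({x'} : Set W'))
    (hyc : IsClosed ({f.base x'} : Set W)) (hperm : IdealSheafData.IsPermissibleAt C (f.base x'))
    (hyC : f.base x' ∈ (C.support : Set W)) (hsurf : 2 ≤ coheight (⟨f.base x', hyC⟩ : ↥(C.support : Set W)))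
    {Z' : Set W'} (hirr : IsIrreducible Z') (hcl : IsClosed Z') (hx' : x' ∈ Z')
    (hup : ∃ B : Set W', IsIrreducible B ∧ IsClosed B ∧ x' ∈ B ∧ B ⊆ Z' ∧ B ≠ {x'} ∧ B ≠ Z') :
    ∃ B : Set W, IsIrreducible B ∧ IsClosed B ∧ f.base x' ∈ B ∧ B ⊆ closure (f.base '' Z') ∧
      B ≠ {f.base x'} ∧ B ≠ closure (f.base '' Z') := by
  by_contra hdown
  haveI hregC : IsRegularLocalRing (W.presheaf.stalk (f.base x') ⧸ stalkIdeal C (f.base x')) := hperm.1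
  obtain ⟨d, hd⟩ : ∃ d : ℕ, ringKrullDim (W.presheaf.stalk (f.base x') ⧸ stalkIdeal C (f.base x')) = d :=
    exists_nat_eq_of_ne_bot_of_ne_top ringKrullDim_ne_bot ringKrullDim_ne_top
  have h2d : 2 ≤ d := by
    have h1 : ((coheight (⟨f.base x', hyC⟩ : ↥(C.support : Set W)) : ℕ∞) : WithBot ℕ∞) ≤ (((d : ℕ) : ℕ∞) : WithBot ℕ∞) := by
      have h1 := coheight_le_ringKrullDim_quotient_stalkIdeal C hyC
      rw [hd] at h1
      rwa [← WithBot.coe_natCast] at h1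
    have h3 : ((2 : ℕ) : ℕ∞) ≤ (d : ℕ∞) := by
      have h4 : (2 : ℕ∞) ≤ (d : ℕ∞) := hsurf.trans (WithBot.coe_le_coe.mp h1)
      exact_mod_cast h4
    exact_mod_cast h3
  have hdimX : ringKrullDim (W.presheaf.stalk (f.base x')) ≤ ((d + 1 + 0 : ℕ) : WithBot ℕ∞) := by
    have hyX : coheight (f.base x') ≤ (3 : ℕ) := (topologicalKrullDim_le_iff_forall_coheight_le W 3).mp hdimW _
    rw [AlgebraicGeometry.ringKrullDim_stalk_eq_coheight]
    have h1 : ((coheight (f.base x') : ℕ∞) : WithBot ℕ∞) ≤ (((3 : ℕ) : ℕ∞) : WithBot ℕ∞) := WithBot.coe_le_coe.mpr hyX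
    rw [WithBot.coe_natCast] at h1
    exact h1.trans (by exact_mod_cast (by omega : 3 ≤ d + 1 + 0))
  have hgen : IsGenericPoint hirr.genericPoint Z' := hirr.isGenericPoint_genericPoint hcl
  set ζ' := hirr.genericPoint with hζ'def
  have hsp : ζ' ⤳ x' := hgen.specializes hx'
  have key := hbl.coheight_closure_le_add_of_isPermissibleAt hsp hperm hd (e := 0) hdimX
  rw [Nat.cast_zero, add_zero] at key
  have h2 : 2 ≤ coheight (⟨x', hx'⟩ : ↥Z') := (two_le_coheight_iff_exists_sandwich hirr hcl hx' hxc).mpr hup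
  have hirrB : IsIrreducible (closure (f.base '' Z')) := (hirr.image f.base f.continuous.continuousOn).closure
  have hBeq : closure (f.base '' Z') = closure {f.base ζ'} := by
    apply le_antisymm
    · refine closure_minimal ?_ isClosed_closure
      rintro _ ⟨z, hz, rfl⟩
      exact specializes_iff_mem_closure.mp ((hgen.specializes hz).map f.continuous)
    · exact closure_minimal (Set.singleton_subset_iff.mpr (subset_closure ⟨ζ', hgen.mem, rfl⟩)) isClosed_closure
  have e1 : coheight (⟨x', hx'⟩ : ↥Z') = coheight (⟨x', specializes_iff_mem_closure.mp hsp⟩ : ↥(closure ({ζ'} : Set W'))) :=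
    (coheight_orderIso (OrderIso.setCongr _ _ hgen.def.symm) ⟨x', hx'⟩).symm
  have e2 : coheight (⟨f.base x', subset_closure ⟨x', hx', rfl⟩⟩ : ↥(closure (f.base '' Z'))) =
      coheight (⟨f.base x', specializes_iff_mem_closure.mp (hsp.map f.continuous)⟩ : ↥(closure ({f.base ζ'} : Set W))) :=
    (coheight_orderIso (OrderIso.setCongr (closure (f.base '' Z')) (closure ({f.base ζ'} : Set W)) hBeq)
      ⟨f.base x', subset_closure ⟨x', hx', rfl⟩⟩).symm
  have hB2 : 2 ≤ coheight (⟨f.base x', subset_closure ⟨x', hx', rfl⟩⟩ : ↥(closure (f.base '' Z'))) := by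
    rw [e2]; exact (e1 ▸ h2).trans key
  exact hdown ((two_le_coheight_iff_exists_sandwich hirrB isClosed_closure (subset_closure ⟨x', hx', rfl⟩) hyc).mp hB2)

/-- **A depth jump over a positive-dimensional centre puts a component of the fibre inside `Z'`** (bare form): `f : W' ⟶ W` a blow-up
of a locally Noetherian `W` of dimension `≤ 3` in `C`, permissible at the closed point `y = f x'` with `1 ≤ codim_{V(C)}(y)`; `x'` closed;
`Z' ∋ x'` irreducible closed with a sandwich at `x'` and none at `y` in `cl f(Z')`. Then some `z'` over `y`, `z' ⤳ x'`, `z' ≠ x'`, maximal in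
the fibre, has `cl z' ⊆ Z'`. [cite: CossartJannsenSaito2020, Thm. 3.10 (proof, p. 46)] [cite: Matsumura1987, Thm. 15.1] -/
theorem IsBlowup.exists_fibre_component_subset_of_sandwich [IsLocallyNoetherian W] [IsLocallyNoetherian W'] (hbl : IsBlowup f C)
    (hdimW : topologicalKrullDim W ≤ ((3 : ℕ) : WithBot ℕ∞)) {x' : W'} (hxc : IsClosed ({x'} : Set W'))
    (hyc : IsClosed ({f.base x'} : Set W)) (hperm : IdealSheafData.IsPermissibleAt C (f.base x'))
    (hyC : f.base x' ∈ (C.support : Set W)) (hpos : 1 ≤ coheight (⟨f.base x', hyC⟩ : ↥(C.support : Set W)))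
    {Z' : Set W'} (hirr : IsIrreducible Z') (hcl : IsClosed Z') (hx' : x' ∈ Z')
    (hup : ∃ B : Set W', IsIrreducible B ∧ IsClosed B ∧ x' ∈ B ∧ B ⊆ Z' ∧ B ≠ {x'} ∧ B ≠ Z')
    (hdown : ¬ ∃ B : Set W, IsIrreducible B ∧ IsClosed B ∧ f.base x' ∈ B ∧ B ⊆ closure (f.base '' Z') ∧
      B ≠ {f.base x'} ∧ B ≠ closure (f.base '' Z')) :
    ∃ z' : W', f.base z' = f.base x' ∧ z' ⤳ x' ∧ z' ≠ x' ∧ (∀ w : W', f.base w = f.base x' → w ⤳ z' → w = z') ∧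
      closure ({z'} : Set W') ⊆ Z' := by
  obtain ⟨z', hz'Z, hzx, hne, hfz⟩ := exists_fibre_generization_of_sandwich f hxc hyc hirr hcl hx' hup hdown
  haveI hregC : IsRegularLocalRing (W.presheaf.stalk (f.base x') ⧸ stalkIdeal C (f.base x')) := hperm.1
  obtain ⟨d, hd⟩ : ∃ d : ℕ, ringKrullDim (W.presheaf.stalk (f.base x') ⧸ stalkIdeal C (f.base x')) = d :=
    exists_nat_eq_of_ne_bot_of_ne_top ringKrullDim_ne_bot ringKrullDim_ne_top
  have h1d : 1 ≤ d := by
    have h1 : ((coheight (⟨f.base x', hyC⟩ : ↥(C.support : Set W)) : ℕ∞) : WithBot ℕ∞) ≤ (((d : ℕ) : ℕ∞) : WithBot ℕ∞) := by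
      have h1 := coheight_le_ringKrullDim_quotient_stalkIdeal C hyC
      rw [hd] at h1
      rwa [← WithBot.coe_natCast] at h1
    have h3 : ((1 : ℕ) : ℕ∞) ≤ (d : ℕ∞) := by
      have h4 : (1 : ℕ∞) ≤ (d : ℕ∞) := hpos.trans (WithBot.coe_le_coe.mp h1)
      exact_mod_cast h4
    exact_mod_cast h3
  have hdimX : ringKrullDim (W.presheaf.stalk (f.base x')) ≤ ((d + 1 + 1 : ℕ) : WithBot ℕ∞) := by
    have hyX : coheight (f.base x') ≤ (3 : ℕ) := (topologicalKrullDim_le_iff_forall_coheight_le W 3).mp hdimW _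
    rw [AlgebraicGeometry.ringKrullDim_stalk_eq_coheight]
    have h1 : ((coheight (f.base x') : ℕ∞) : WithBot ℕ∞) ≤ (((3 : ℕ) : ℕ∞) : WithBot ℕ∞) := WithBot.coe_le_coe.mpr hyX
    rw [WithBot.coe_natCast] at h1
    exact h1.trans (by exact_mod_cast (by omega : 3 ≤ d + 1 + 1))
  have hF1 : coheight (⟨x', rfl⟩ : ↥(f.base ⁻¹' {f.base x'})) ≤ 1 :=
    hbl.coheight_preimage_le_of_isPermissibleAt x' hperm hd (e := 1) hdimX
  refine ⟨z', hfz, hzx, hne, ?_, closure_minimal (Set.singleton_subset_iff.mpr hz'Z) hcl⟩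
  intro w hw hwz
  by_contra hwne
  have hzF : z' ∈ f.base ⁻¹' {f.base x'} := hfz
  have hwF : w ∈ f.base ⁻¹' {f.base x'} := hw
  have hxz : (⟨x', rfl⟩ : ↥(f.base ⁻¹' {f.base x'})) < ⟨z', hzF⟩ := by
    refine lt_iff_le_not_ge.mpr ⟨Scheme.le_iff_specializes.mpr hzx, fun hle => hne ?_⟩
    exact ((Scheme.le_iff_specializes.mp hle).antisymm hzx).eq.symm
  have hzw : (⟨z', hzF⟩ : ↥(f.base ⁻¹' {f.base x'})) < ⟨w, hwF⟩ := by
    refine lt_iff_le_not_ge.mpr ⟨Scheme.le_iff_specializes.mpr hwz, fun hle => hwne ?_⟩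
    exact ((Scheme.le_iff_specializes.mp hle).antisymm hwz).eq.symm
  have h' := length_le_coheight_head (p := ((RelSeries.singleton _ (⟨x', rfl⟩ : ↥(f.base ⁻¹' {f.base x'}))).snoc
    ⟨z', hzF⟩ hxz).snoc ⟨w, hwF⟩ (by rw [RelSeries.last_snoc]; exact hzw))
  simp only [RelSeries.snoc_length, RelSeries.singleton_length, zero_add, RelSeries.head_snoc,
    RelSeries.head_singleton] at h'
  have h2 : (2 : ℕ∞) ≤ 1 := (by exact_mod_cast h' : (2 : ℕ∞) ≤ _).trans hF1
  exact absurd h2 (by decide)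

end Summit.ResolutionOfSingularities.ResolutionOfSingularities.Theorems.SigmaMaxModificationsCorridor3.Moving

end
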